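import Literature.Geometry.Manifold.DeRhamFundamentalClassPairing
import HarnessLib

/-!
# The integral of a closed top form is proportional to its period on the fundamental class

Topic `Literature/Geometry/Manifold` (de Rham theory ↔ singular homology), a complement to
`DeRhamFundamentalClassPairing.lean`. On a closed connected smooth `n`-manifold `M` (charted on
`ℝⁿ`) with a continuous orientation family `o` (the tree's integration theory `MForm.integral`,
Lee (2013), Ch. 16) and ANY homological `ℤ`-orientation `μ` (`[M] = μ.fundamentalClass`), the two
real-valued functionals on closed smooth top forms

* `t ↦ ∫_{(M, o)} t` and
* `t ↦ ⟨e_M [t], [M] ⊗ 1⟩` (de Rham's integration isomorphism `e_M = integrationDeRhamIsoFamily`,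
  then the Kronecker pairing with the real fundamental class)

are PROPORTIONAL: `exists_integral_eq_mul_kroneckerPairing` — there is a real constant `c`
(depending on `M`, `o`, `μ` only) with `∫_M t = c · ⟨e_M [t], [M] ⊗ 1⟩` for every closed smooth
top form `t`. Classically `c = ±1` ("the de Rham isomorphism in top degree is integration",
Bott–Tu (1982), §I.5–6; Lee (2013), Thm. 17.31 with Thm. 18.14: `∫_M : Hⁿ_dR(M) ≅ ℝ`); the
proportionality is what estimates consume (an integral bounded by a homological quantity) and is
all that is proved here: both functionals are linear and vanish on exact forms (Stokes,
`MForm.integral_eq_zero_of_mem_exactSmoothForms_holds`; well-definedness of `e_M` on classes), and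
the second detects classes — `⟨e_M [t], [M] ⊗ 1⟩ = 0` forces `[t] = 0` (Hatcher (2002),
Thm. 3.26: `Hₙ(M; ℝ)` is the line spanned by `[M] ⊗ 1`, the tree's
`eq_zero_of_kroneckerPairing_coeffChange_fundamentalClass_eq_zero`, and `e_M` is injective), so the
first factors through the second.

Everything is proved; no definitions, no named facts. Used by
`Literature/Geometry/Symplectic/GromovCompactnessSpheresEnergy.lean` (the energy
`∫_{ℂℙ¹} u^*ω` of a sphere is proportional to the symplectic period `⟨[ω], [u]⟩`, hence constant on
homotopy classes: the energy bound of Gromov compactness, McDuff–Salamon (2012), Lemma 2.2.1).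

## References

* J. M. Lee, *Introduction to Smooth Manifolds*, 2nd ed., GTM 218 (2013), Prop. 16.6, Cor. 16.13,
  Thm. 17.31, Thm. 18.14. [LeeSmoothManifolds2013]
* R. Bott, L. W. Tu, *Differential Forms in Algebraic Topology*, GTM 82 (1982), §I.5–6.
  [BottTu1982Forms]
* A. Hatcher, *Algebraic Topology*, CUP (2002), §3.3 Thm. 3.26. [HatcherAT2002]
-/

noncomputable section

open scoped Manifold ContDiff Topology EuclideanSpace
open Set Function Module
open Literature.AlgebraicTopology.SingularHomology Literature.Geometry.Kaehler
  Literature.NumberTheory.Transcendental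

namespace Literature.Geometry.Manifold

variable {n : ℕ} {M : Type} [TopologicalSpace M] [T2Space M] [CompactSpace M] [ConnectedSpace M]
  [ChartedSpace (EuclideanSpace ℝ (Fin n)) M] [IsManifold (𝓡 n) ∞ M]

/-- **Zero period forces zero integral.** For a closed smooth top form `t` on a closed connected
oriented `n`-manifold: if `⟨e_M [t], [M] ⊗ 1⟩ = 0` then `∫_M t = 0` (the pairing detects
`Hⁿ(M; ℝ)`, Hatcher (2002), Thm. 3.26, so `e_M [t] = 0`, `[t] = 0`, `t` is exact, and exact forms
integrate to zero by Stokes, Lee (2013), Cor. 16.13). [cite: LeeSmoothManifolds2013, Cor. 16.13] -/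
theorem integral_eq_zero_of_kroneckerPairing_eq_zero (μ : HomologicalOrientation ℤ M n)
    {o : (x : M) → Orientation ℝ (TangentSpace (𝓡 n) x) (Fin n)}
    (ho : IsContinuousOrientation (I := 𝓡 n) o) (t : closedSmoothForms (𝓡 n) M ℝ n)
    (h0 : kroneckerPairing ℝ ℝ M n
      (integrationDeRhamIsoFamily (EuclideanSpace ℝ (Fin n)) M n (deRhamCohomology.mk t))
      (singularHomology.coeffChange M (algebraMap ℤ ℝ : ℤ →+* ℝ).toAddMonoidHom n
        μ.fundamentalClass) = 0) :
    (t : MForm (𝓡 n) M ℝ n).integral o = 0 := by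
  have h1 : integrationDeRhamIsoFamily (EuclideanSpace ℝ (Fin n)) M n (deRhamCohomology.mk t) = 0 :=
    eq_zero_of_kroneckerPairing_coeffChange_fundamentalClass_eq_zero ℝ μ h0
  have h2 : deRhamCohomology.mk t = 0 := (LinearEquiv.map_eq_zero_iff _).1 h1
  exact MForm.integral_eq_zero_of_mem_exactSmoothForms_holds o ho
    (mem_exactSmoothForms_of_mk_eq_zero _ h2)

/-- **The integral of a closed top form is a constant multiple of its period on the fundamental
class**: on a closed connected `n`-manifold with a continuous orientation family `o` and any
`ℤ`-orientation `μ`, there is `c : ℝ` with `∫_{(M, o)} t = c · ⟨e_M [t], [M]_μ ⊗ 1⟩` for every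
closed smooth top form `t` (both sides are linear in `t` and kill exact forms, and the right side
detects de Rham classes; classically `c = ±1`, Bott–Tu (1982), §I.5–6, Lee (2013), Thm. 17.31 —
only the proportionality is recorded). [cite: LeeSmoothManifolds2013, Thm. 17.31 and Thm. 18.14] -/
theorem exists_integral_eq_mul_kroneckerPairing (μ : HomologicalOrientation ℤ M n)
    {o : (x : M) → Orientation ℝ (TangentSpace (𝓡 n) x) (Fin n)}
    (ho : IsContinuousOrientation (I := 𝓡 n) o) :
    ∃ c : ℝ, ∀ t : closedSmoothForms (𝓡 n) M ℝ n,
      (t : MForm (𝓡 n) M ℝ n).integral o = c * kroneckerPairing ℝ ℝ M n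
        (integrationDeRhamIsoFamily (EuclideanSpace ℝ (Fin n)) M n (deRhamCohomology.mk t))
        (singularHomology.coeffChange M (algebraMap ℤ ℝ : ℤ →+* ℝ).toAddMonoidHom n
          μ.fundamentalClass) := by
  -- the two functionals
  set z := singularHomology.coeffChange M (algebraMap ℤ ℝ : ℤ →+* ℝ).toAddMonoidHom n
    μ.fundamentalClass with hz
  set K : closedSmoothForms (𝓡 n) M ℝ n →ₗ[ℝ] ℝ :=
    (kroneckerPairing ℝ ℝ M n).flip z ∘ₗ
      (integrationDeRhamIsoFamily (EuclideanSpace ℝ (Fin n)) M n).toLinearMap ∘ₗ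
        deRhamCohomology.mk with hK
  have hKapply : ∀ t : closedSmoothForms (𝓡 n) M ℝ n, K t = kroneckerPairing ℝ ℝ M n
      (integrationDeRhamIsoFamily (EuclideanSpace ℝ (Fin n)) M n (deRhamCohomology.mk t)) z :=
    fun t ↦ rfl
  have hker : ∀ t : closedSmoothForms (𝓡 n) M ℝ n, K t = 0 → (t : MForm (𝓡 n) M ℝ n).integral o = 0 :=
    fun t ht ↦ integral_eq_zero_of_kroneckerPairing_eq_zero μ ho t (by rwa [hKapply] at ht)
  by_cases hψ : ∀ t : closedSmoothForms (𝓡 n) M ℝ n, K t = 0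
  · refine ⟨0, fun t ↦ ?_⟩
    rw [hker t (hψ t), ← hKapply, hψ t, mul_zero]
  push Not at hψ
  obtain ⟨t₀, h0⟩ := hψ
  refine ⟨(t₀ : MForm (𝓡 n) M ℝ n).integral o / K t₀, fun t ↦ ?_⟩
  -- `s = t - (K t / K t₀) • t₀` has zero period, hence zero integral
  set s : closedSmoothForms (𝓡 n) M ℝ n := t - (K t / K t₀) • t₀ with hs
  have hKs : K s = 0 := by
    rw [hs, map_sub, map_smul, smul_eq_mul, div_mul_cancel₀ _ h0, sub_self]
  have hIs : (s : MForm (𝓡 n) M ℝ n).integral o =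
      (t : MForm (𝓡 n) M ℝ n).integral o - K t / K t₀ * (t₀ : MForm (𝓡 n) M ℝ n).integral o := by
    rw [hs, Submodule.coe_sub, Submodule.coe_smul]
    exact MForm.integral_sub_smul o ho (MForm.integral_add_holds o) t.2.1 t₀.2.1 _
  have h := hker s hKs
  rw [hIs] at h
  rw [← hKapply]
  have h' : (t : MForm (𝓡 n) M ℝ n).integral o =
      K t / K t₀ * (t₀ : MForm (𝓡 n) M ℝ n).integral o := by linarith
  rw [h']
  ring

end Literature.Geometry.Manifold

end
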